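import Mathlib
import HarnessLib
import Summits.HubbardSuperconductivity.HubbardSuperconductivity.Theorems.KLProgrammeKLRegimeEngineTowerDoorToKitPrescribed

/-!
# LINK-F (iii) — the ORIENTED door's right side is dominated by the kit's step right side, with the floor credit kept explicit
# (crux K3 ENGINE, stmt-HubbardSuperconductivity-20437 `KLRegimeEngineV17F2`, stub (b) v2, levels package (ℓ), cure of located item #10 «(ℓ)-LEV-ODD»;
#  cell gate-hubbard-kl, seat hubbard-kl-k3c3-p2 g15 — E1 / p4's LINK-F lane may rename or supersede)

The oriented levelled door (`…TowerBlockStepWtOriented`, on the tower `…TowerBlockIncrLevOriented[Talking]`) has the graded bracket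
`Σ_{n ∈ [2,N₀)} κ^{-(m+1)} κ^{-2(n−1)} (α_g^{n−1} eⁿ) · Σ_δ Σ_{pf} w_pf(δ) · ((e³κ)^{Σ_a 2δ_a} · ((∏_a Bm(δ_a)) · θL))`
(line constant `α_g = c·α`, landing-profile weights `w_pf`, a pf-FREE profile functional carrying the floor credit `θL = θ^{lumps(1+|J|)}`)
and the flat tail in `normV Γ κ ρ (m′ ↦ ε·B m′ 0)` with the plain `α`.  Exactly as `doorGradedPrescribed_le_kitStep` did for the
all-known door, this file dominates it by the kit's step right side — `towerS D τ Bm n p` for the graded part (the floor credit `θL`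
factored OUT in front), `towerV D τ Nt` for the tail (a track-blind level-`0` majorant `ε·B m′ 0 ≤ Nt m′`):

* §1 `geomTail_mono₂` (the geometric tail is monotone in the size AND in the ratio), `prod_pow_two_mul_eq_pow_sum`;
* §2 **`doorGradedOriented_le_kitStep`**.
Pure real inequalities; nothing about the model is asserted; nothing asserts (ℓ), any stub, K3 or superconductivity.
References: BGM 2006 §2.8 (2.82)–(2.84), (2.88)–(2.90), §3 (3.2)–(3.8) [cite: BenfattoGiulianiMastropietro2006].
-/

noncomputable section

namespace Summit.HubbardSuperconductivity.HubbardSuperconductivity.Theorems.EngineV8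

set_option linter.dupNamespace false -- summit = problem name (single-conjunct summit), D-0017

open Real Finset Literature.MathematicalPhysics.QuantumLattice
open scoped Nat

/-! ## §1 Elementary rows -/

/-- **The geometric tail is monotone in the size and in the ratio**: `0 ≤ V ≤ V′`, `0 ≤ a ≤ a′ < 1` ⇒
`e·V·a^N/(1−a) ≤ e·V′·a′^N/(1−a′)`. -/
theorem geomTail_mono₂ {V V' a a' : ℝ} (hV : 0 ≤ V) (hVV : V ≤ V') (ha : 0 ≤ a) (haa : a ≤ a') (ha' : a' < 1) (N : ℕ) :
    exp 1 * V * a ^ N / (1 - a) ≤ exp 1 * V' * a' ^ N / (1 - a') := by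
  have hV' : 0 ≤ V' := hV.trans hVV
  have h1 : 0 < 1 - a' := sub_pos.2 ha'
  have hnum : exp 1 * V * a ^ N ≤ exp 1 * V' * a' ^ N :=
    mul_le_mul (mul_le_mul_of_nonneg_left hVV (exp_pos _).le) (pow_le_pow_left₀ ha haa N) (pow_nonneg ha _)
      (mul_nonneg (exp_pos _).le hV')
  exact div_le_div₀ (mul_nonneg (mul_nonneg (exp_pos _).le hV') (pow_nonneg (ha.trans haa) _)) hnum h1 (by linarith)

/-- `x^{Σ_a 2δ_a} = ∏_a (x²)^{δ_a}`. -/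
theorem pow_sum_two_mul_eq_prod_pow_sq {n : ℕ} (x : ℝ) (δ : Fin n → ℕ) :
    x ^ (∑ a, 2 * δ a) = ∏ a, (x ^ 2) ^ (δ a) := by
  rw [← prod_pow_eq_pow_sum]
  exact prod_congr rfl fun a _ => pow_mul x 2 (δ a)

/-! ## §2 The oriented bracket under the kit's step right side -/

/-- **THE ORIENTED DOOR'S BRACKET IS DOMINATED BY THE KIT'S STEP RIGHT SIDE, FLOOR CREDIT IN FRONT.**  Data: `κ, ρ > 0`, line constants
`0 ≤ α ≤ α_g` (tail / graded), `ε ≥ 0`, a floor credit `θL ≥ 0`; graded sizes `Bm ≥ 0` with `Bm 0 = 0`; level-`0` tail sizes `B m′ 0 ≥ 0`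
under a track-blind majorant `Nt ≥ 0`, `Nt 0 = 0`, `ε·B m′ 0 ≤ Nt m′`; `D ≥ |Γ|/2`; `N₀ ≥ 2`; output degree `m + 1 = 2p`; kit parameters
`τ ≥ (e³κ)², (e²(κ+ρ))²` and `ψ ≥ κ⁻², ρ⁻²`; the kit guard `Φ·towerV D τ Nt < 1` at `Φ := e·α_g/κ²`.  Then
`[oriented graded bracket] + [tail] ≤ θL · Σ_{n∈[2,N₀−1]} e·Φ^{n−1}·ψ^p·towerS D τ Bm n p + ψ^p·(e·V·(ΦV)^{N₀−1}/(1−ΦV))`, `V := towerV D τ Nt`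
(landing weights average to `≤ 1`; `(e³κ)^{Σ2δ} = ∏ ((e³κ)²)^{δ_a} ≤ ∏ τ^{δ_a}`; range enlargement and `sum_range_filter_prod_eq_towerS`; the
tail by `normV ≤ towerV` and monotonicity of the geometric tail in size and ratio, `α ≤ α_g`). -/
theorem doorGradedOriented_le_kitStep {Γ : Type*} [Fintype Γ] {Jt : Type*} [Fintype Jt] [DecidableEq Jt]
    {κ ρ α αg ε θL : ℝ} (hκ : 0 < κ) (hρ : 0 < ρ) (hα : 0 ≤ α) (hαg : α ≤ αg) (hε : 0 ≤ ε) (hθL : 0 ≤ θL)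
    {Bm : ℕ → ℝ} (hBm0 : ∀ m, 0 ≤ Bm m) (hBm00 : Bm 0 = 0)
    {B : ℕ → ℕ → ℝ} (hB0 : ∀ m, 0 ≤ B m 0) {Nt : ℕ → ℝ} (hNt0 : ∀ m, 0 ≤ Nt m) (hNt00 : Nt 0 = 0)
    (hNtB : ∀ m, ε * B m 0 ≤ Nt m)
    {D : ℕ} (hD : Fintype.card Γ / 2 ≤ D) {N₀ : ℕ} (hN₀ : 2 ≤ N₀) {m p : ℕ} (hmp : m + 1 = 2 * p)
    {τ ψ : ℝ} (hτ1 : (exp 3 * κ) ^ 2 ≤ τ) (hτ2 : (exp 2 * (κ + ρ)) ^ 2 ≤ τ) (hψ1 : κ⁻¹ ^ 2 ≤ ψ) (hψ2 : ρ⁻¹ ^ 2 ≤ ψ)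
    (hguard : exp 1 * αg / κ ^ 2 * towerV D τ Nt < 1) :
    (∑ n ∈ Ico 2 N₀, (κ⁻¹ ^ (m + 1) * κ⁻¹ ^ (2 * (n - 1)) * (αg ^ (n - 1) * exp n)) *
        ∑ δ ∈ (Fintype.piFinset fun _ : Fin n => range (Fintype.card Γ / 2 + 1)) with m + 1 + 2 * (n - 1) ≤ ∑ a, 2 * δ a,
          ∑ pf : Jt → Fin n, ((∏ j, ((2 * δ (pf j) : ℕ) : ℝ)) / ((∑ a, 2 * δ a : ℕ) : ℝ) ^ Fintype.card Jt) *
            ((exp 3 * κ) ^ (∑ a, 2 * δ a) * ((∏ a, Bm (δ a)) * θL))) +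
      ρ⁻¹ ^ (m + 1) * (exp 1 * normV Γ κ ρ (fun m' => ε * B m' 0)) *
        (exp 1 * α * normV Γ κ ρ (fun m' => ε * B m' 0) / κ ^ 2) ^ (N₀ - 1) /
        (1 - exp 1 * α * normV Γ κ ρ (fun m' => ε * B m' 0) / κ ^ 2) ≤
    θL * ∑ n ∈ Icc 2 (N₀ - 1), exp 1 * (exp 1 * αg / κ ^ 2) ^ (n - 1) * ψ ^ p * towerS D τ Bm n p +
      ψ ^ p * (exp 1 * towerV D τ Nt * (exp 1 * αg / κ ^ 2 * towerV D τ Nt) ^ (N₀ - 1) /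
        (1 - exp 1 * αg / κ ^ 2 * towerV D τ Nt)) := by
  set Φ := exp 1 * αg / κ ^ 2 with hΦ
  have hαg0 : 0 ≤ αg := hα.trans hαg
  have hΦ0 : 0 ≤ Φ := by rw [hΦ]; positivity
  have he3 : 0 ≤ exp 3 * κ := by positivity
  have hτ0 : 0 ≤ (exp 3 * κ) ^ 2 := by positivity
  have hτ0' : 0 ≤ τ := hτ0.trans hτ1
  have hψ0 : 0 ≤ ψ := le_trans (by positivity) hψ1
  have hIco : Ico 2 N₀ = Icc 2 (N₀ - 1) := by
    ext n; simp only [mem_Ico, mem_Icc]; omega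
  refine add_le_add ?_ ?_
  · -- graded part, order by order, the floor credit pulled in front
    rw [hIco, mul_sum]
    refine sum_le_sum fun n hn => ?_
    have hn1 : 1 ≤ n := by have := (mem_Icc.1 hn).1; omega
    have hcoef : κ⁻¹ ^ (m + 1) * κ⁻¹ ^ (2 * (n - 1)) * (αg ^ (n - 1) * exp n) = exp 1 * Φ ^ (n - 1) * (κ⁻¹ ^ 2) ^ p := by
      have h := door_coef_eq hκ.ne' (ρ := κ) αg p (n - 1)
      rw [show n - 1 + 1 = n by omega] at h
      rw [hmp, hΦ]
      exact h
    rw [hcoef]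
    have hc0 : 0 ≤ exp 1 * Φ ^ (n - 1) * (κ⁻¹ ^ 2) ^ p := by positivity
    have hcψ : exp 1 * Φ ^ (n - 1) * (κ⁻¹ ^ 2) ^ p ≤ exp 1 * Φ ^ (n - 1) * ψ ^ p :=
      mul_le_mul_of_nonneg_left (pow_le_pow_left₀ (by positivity) hψ1 p) (by positivity)
    -- inner sum: average the profiles away, enlarge `(e³κ)²` to `τ`, enlarge the range, then it IS `θL · towerS`
    have hinner : ∑ δ ∈ (Fintype.piFinset fun _ : Fin n => range (Fintype.card Γ / 2 + 1)) with m + 1 + 2 * (n - 1) ≤ ∑ a, 2 * δ a,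
          ∑ pf : Jt → Fin n, ((∏ j, ((2 * δ (pf j) : ℕ) : ℝ)) / ((∑ a, 2 * δ a : ℕ) : ℝ) ^ Fintype.card Jt) *
            ((exp 3 * κ) ^ (∑ a, 2 * δ a) * ((∏ a, Bm (δ a)) * θL)) ≤
        θL * towerS D τ Bm n p := by
      have hsub : ((Fintype.piFinset fun _ : Fin n => range (Fintype.card Γ / 2 + 1)).filter
            fun δ : Fin n → ℕ => m + 1 + 2 * (n - 1) ≤ ∑ a, 2 * δ a) ⊆
          ((Fintype.piFinset fun _ : Fin n => range (D + 1)).filter fun δ : Fin n → ℕ => 2 * p + 2 * (n - 1) ≤ ∑ a, 2 * δ a) := by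
        intro δ hδ
        rw [mem_filter, Fintype.mem_piFinset] at hδ ⊢
        exact ⟨fun a => mem_range.2 (lt_of_lt_of_le (mem_range.1 (hδ.1 a)) (by omega)), hmp ▸ hδ.2⟩
      -- per multi-degree `δ`
      have hδ : ∀ δ : Fin n → ℕ,
          ∑ pf : Jt → Fin n, ((∏ j, ((2 * δ (pf j) : ℕ) : ℝ)) / ((∑ a, 2 * δ a : ℕ) : ℝ) ^ Fintype.card Jt) *
              ((exp 3 * κ) ^ (∑ a, 2 * δ a) * ((∏ a, Bm (δ a)) * θL)) ≤
            θL * ∏ a, τ ^ (δ a) * Bm (δ a) := by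
        intro δ
        have hX0 : 0 ≤ (exp 3 * κ) ^ (∑ a, 2 * δ a) * ((∏ a, Bm (δ a)) * θL) :=
          mul_nonneg (pow_nonneg he3 _) (mul_nonneg (prod_nonneg fun a _ => hBm0 _) hθL)
        have hX : (exp 3 * κ) ^ (∑ a, 2 * δ a) * ((∏ a, Bm (δ a)) * θL) ≤ θL * ∏ a, τ ^ (δ a) * Bm (δ a) := by
          rw [pow_sum_two_mul_eq_prod_pow_sq, ← mul_assoc, ← prod_mul_distrib, mul_comm _ θL]
          refine mul_le_mul_of_nonneg_left (prod_le_prod (fun a _ => mul_nonneg (pow_nonneg hτ0 _) (hBm0 _)) fun a _ => ?_) hθL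
          exact mul_le_mul_of_nonneg_right (pow_le_pow_left₀ hτ0 hτ1 _) (hBm0 _)
        calc _ ≤ ∑ pf : Jt → Fin n, ((∏ j, ((2 * δ (pf j) : ℕ) : ℝ)) / ((∑ a, 2 * δ a : ℕ) : ℝ) ^ Fintype.card Jt) *
              (θL * ∏ a, τ ^ (δ a) * Bm (δ a)) :=
              sum_le_sum fun pf _ => mul_le_mul_of_nonneg_left hX (by positivity)
          _ = (∑ pf : Jt → Fin n, (∏ j, ((2 * δ (pf j) : ℕ) : ℝ)) / ((∑ a, 2 * δ a : ℕ) : ℝ) ^ Fintype.card Jt) *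
              (θL * ∏ a, τ ^ (δ a) * Bm (δ a)) := by rw [sum_mul]
          _ ≤ 1 * (θL * ∏ a, τ ^ (δ a) * Bm (δ a)) :=
              mul_le_mul_of_nonneg_right (sum_landingWeights_cast_le_one δ)
                (mul_nonneg hθL (prod_nonneg fun a _ => mul_nonneg (pow_nonneg hτ0' _) (hBm0 _)))
          _ = _ := one_mul _
      calc _ ≤ ∑ δ ∈ (Fintype.piFinset fun _ : Fin n => range (Fintype.card Γ / 2 + 1)) with m + 1 + 2 * (n - 1) ≤ ∑ a, 2 * δ a,
            θL * ∏ a, τ ^ (δ a) * Bm (δ a) := sum_le_sum fun δ _ => hδ δ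
        _ ≤ ∑ δ ∈ (Fintype.piFinset fun _ : Fin n => range (D + 1)) with 2 * p + 2 * (n - 1) ≤ ∑ a, 2 * δ a,
            θL * ∏ a, τ ^ (δ a) * Bm (δ a) :=
            sum_le_sum_of_subset_of_nonneg hsub fun δ _ _ =>
              mul_nonneg hθL (prod_nonneg fun a _ => mul_nonneg (pow_nonneg hτ0' _) (hBm0 _))
        _ = θL * towerS D τ Bm n p := by rw [← mul_sum, sum_range_filter_prod_eq_towerS hn1 hBm00 p]
    have hS0 : 0 ≤ towerS D τ Bm n p := towerS_nonneg hτ0' hBm0 n p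
    calc _ ≤ exp 1 * Φ ^ (n - 1) * (κ⁻¹ ^ 2) ^ p * (θL * towerS D τ Bm n p) := mul_le_mul_of_nonneg_left hinner hc0
      _ ≤ exp 1 * Φ ^ (n - 1) * ψ ^ p * (θL * towerS D τ Bm n p) := mul_le_mul_of_nonneg_right hcψ (mul_nonneg hθL hS0)
      _ = θL * (exp 1 * Φ ^ (n - 1) * ψ ^ p * towerS D τ Bm n p) := by ring
  · -- tail: `normV(ε·B·0) ≤ towerV D τ Nt`, `α ≤ α_g`, monotone tail, `ρ⁻² ≤ ψ`
    have hN'0 : ∀ m', 0 ≤ ε * B m' 0 := fun m' => mul_nonneg hε (hB0 _)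
    have hV1 : normV Γ κ ρ (fun m' => ε * B m' 0) ≤ normV Γ κ ρ Nt := normV_mono hκ.le hρ.le hNtB
    have hV2 : normV Γ κ ρ Nt ≤ towerV D ((exp 2 * (κ + ρ)) ^ 2) Nt := normV_le_towerV hκ.le hρ.le hNt0 hNt00 hD
    have hV3 : towerV D ((exp 2 * (κ + ρ)) ^ 2) Nt ≤ towerV D τ Nt := towerV_mono (by positivity) hτ2 hNt0 fun _ => le_rfl
    have hV := hV1.trans (hV2.trans hV3)
    have hV0 : 0 ≤ normV Γ κ ρ (fun m' => ε * B m' 0) := normV_nonneg hκ.le hρ.le hN'0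
    have ha0 : 0 ≤ exp 1 * α * normV Γ κ ρ (fun m' => ε * B m' 0) / κ ^ 2 := by positivity
    have haa : exp 1 * α * normV Γ κ ρ (fun m' => ε * B m' 0) / κ ^ 2 ≤ Φ * towerV D τ Nt := by
      rw [hΦ]
      calc exp 1 * α * normV Γ κ ρ (fun m' => ε * B m' 0) / κ ^ 2
          = exp 1 / κ ^ 2 * (α * normV Γ κ ρ (fun m' => ε * B m' 0)) := by ring
        _ ≤ exp 1 / κ ^ 2 * (αg * towerV D τ Nt) :=
            mul_le_mul_of_nonneg_left (mul_le_mul hαg hV hV0 hαg0) (by positivity)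
        _ = exp 1 * αg / κ ^ 2 * towerV D τ Nt := by ring
    have htail := geomTail_mono₂ hV0 hV ha0 haa hguard (N₀ - 1)
    have hψp : ρ⁻¹ ^ (m + 1) ≤ ψ ^ p := by
      rw [hmp, pow_mul]; exact pow_le_pow_left₀ (by positivity) hψ2 p
    have hTl0 : 0 ≤ exp 1 * normV Γ κ ρ (fun m' => ε * B m' 0) *
        (exp 1 * α * normV Γ κ ρ (fun m' => ε * B m' 0) / κ ^ 2) ^ (N₀ - 1) /
        (1 - exp 1 * α * normV Γ κ ρ (fun m' => ε * B m' 0) / κ ^ 2) :=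
      div_nonneg (by positivity) (sub_nonneg.2 ((haa.trans hguard.le)))
    rw [mul_assoc (ρ⁻¹ ^ (m + 1)), mul_div_assoc]
    exact mul_le_mul hψp htail hTl0 (pow_nonneg hψ0 _)

end Summit.HubbardSuperconductivity.HubbardSuperconductivity.Theorems.EngineV8

end
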